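import Summits.ResolutionOfSingularities.ResolutionOfSingularities.Theorems.WildDescent1
import HarnessLib

/-!
# WildDescent (2/13) — β-descent in a linear frame; §1 Points: Hironaka point sets `pts`, `lexMin`, `minSnd`, the toric maps `phi`/`psi`, `pts_lattice` (β-lattice law)

Verbatim slice of the farm-checked monolith `WildDescent.lean` of cell `decomp-res`, seat `decomp-res-lens-5`, g36
(sha256 4ec0fa6f4f9efba7…); one namespace `Summit.ResolutionOfSingularities.ResolutionOfSingularities.Theorems.WildDescent` across the
slices, imports chained (laws L1–L7 and the mechanism: module docstring of slice 1; main theorems: slice 13/13).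
-/

open MvPolynomial Finset
open scoped BigOperators
open Literature.AlgebraicGeometry.Resolution
open Literature.AlgebraicGeometry.Resolution.Hauser2010
open Literature.AlgebraicGeometry.Resolution.PointBlowup
open Literature.AlgebraicGeometry.Resolution.HauserPerlega2024

namespace Summit.ResolutionOfSingularities.ResolutionOfSingularities.Theorems.WildDescent

/-! ## §1 Hironaka's point sets `Δ(H; u, v; f) ⊂ ℚ²`, lexicographic minima, and the two toric maps -/

section Points

variable {σ : Type*} {K : Type*} [CommSemiring K]

/-- Hironaka's projection of an exponent from the vertex `y_f^s`: `d ↦ (d_u /(s − d_f), d_v /(s − d_f))`.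
DEFINITION (data; meaningful for `d_f < s`). [cite: CossartJannsenSaito2020, Def 8.1 p.107] -/
def pt (s : ℕ) (f u v : σ) (d : σ →₀ ℕ) : ℚ × ℚ :=
  (((d u : ℕ) : ℚ) / ((s - d f : ℕ) : ℚ), ((d v : ℕ) : ℚ) / ((s - d f : ℕ) : ℚ))

/-- The POINT SET `Δ(H; u, v; f)`: projections of the exponents of `H` lying below level `s` in `y_f`
(Hironaka's characteristic polyhedron is its positive convex hull; we never take hulls). DEFINITION (data).
[cite: CossartJannsenSaito2020, Def 8.1 p.107] -/
def pts (s : ℕ) (f u v : σ) (H : MvPolynomial σ K) : Finset (ℚ × ℚ) :=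
  (H.support.filter fun d => d f < s).image (pt s f u v)

/-- Membership in the point set `Δ(H; u,v; f)`: `x ∈ pts` iff some support monomial `d` with `d f < s` projects to `x`. [folklore] -/
theorem mem_pts {s : ℕ} {f u v : σ} {H : MvPolynomial σ K} {x : ℚ × ℚ} :
    x ∈ pts s f u v H ↔ ∃ d ∈ H.support, d f < s ∧ pt s f u v d = x := by
  unfold pts
  simp only [Finset.mem_image, Finset.mem_filter, and_assoc]

/-- A support monomial with `d f < s` contributes its projected point to `Δ(H; u,v; f)`. [folklore] -/
theorem pt_mem_pts {s : ℕ} {f u v : σ} {H : MvPolynomial σ K} {d : σ →₀ ℕ} (hd : d ∈ H.support) (hdf : d f < s) :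
    pt s f u v d ∈ pts s f u v H :=
  mem_pts.mpr ⟨d, hd, hdf, rfl⟩

/-- **THE β-LATTICE LAW.**  Every point of `Δ(H; u, v; f)` has BOTH coordinates in `(1/D)·ℕ` for one denominator
`1 ≤ D ≤ s` — uniformly along any chain of order `s`: the invariants `α, β, ε` live in the fixed lattice `(1/s!)·ℕ`,
which is what makes the β-descent terminate. [cite: CossartJannsenSaito2020, proof of
Thm 12.3 p.133; folklore] -/
theorem pts_lattice {s : ℕ} {f u v : σ} {H : MvPolynomial σ K} :
    ∀ x ∈ pts s f u v H, ∃ D a b : ℕ, 1 ≤ D ∧ D ≤ s ∧ x = (((a : ℕ) : ℚ) / (D : ℚ), ((b : ℕ) : ℚ) / (D : ℚ)) := by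
  intro x hx
  obtain ⟨d, -, hdf, rfl⟩ := mem_pts.mp hx
  exact ⟨s - d f, d u, d v, by omega, by omega, rfl⟩

/-- The LEXICOGRAPHIC MINIMUM of a finite set of points (the vertex `(α, β)` of Hironaka's game; `0` on `∅`).
DEFINITION (data). [cite: CossartJannsenSaito2020, Def 10.1 p.124] -/
def lexMin (S : Finset (ℚ × ℚ)) : ℚ × ℚ :=
  if h : S.Nonempty then ofLex ((S.image toLex).min' (h.image toLex)) else 0

/-- The lexicographic minimum of a nonempty finite set of points belongs to the set. [folklore] -/
theorem lexMin_mem {S : Finset (ℚ × ℚ)} (h : S.Nonempty) : lexMin S ∈ S := by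
  unfold lexMin
  rw [dif_pos h]
  have hm := Finset.min'_mem (S.image toLex) (h.image toLex)
  rw [Finset.mem_image] at hm
  obtain ⟨x, hx, hxe⟩ := hm
  rw [← hxe]
  exact hx

/-- The lexicographic minimum is lexicographically below every point of the set. [folklore] -/
theorem lexMin_le {S : Finset (ℚ × ℚ)} {x : ℚ × ℚ} (hx : x ∈ S) : toLex (lexMin S) ≤ toLex x := by
  unfold lexMin
  rw [dif_pos ⟨x, hx⟩, toLex_ofLex]
  exact Finset.min'_le _ _ (Finset.mem_image_of_mem toLex hx)

/-- Characterisation of the lexicographic minimum. [folklore] -/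
theorem lexMin_eq {S : Finset (ℚ × ℚ)} {v : ℚ × ℚ} (hv : v ∈ S) (h : ∀ w ∈ S, toLex v ≤ toLex w) : lexMin S = v := by
  have h1 := h _ (lexMin_mem ⟨v, hv⟩)
  have h2 := lexMin_le hv
  exact toLex.injective (le_antisymm h2 h1)

/-- The abscissa of the lexicographic minimum (`α`) is the least abscissa of the set. [folklore] -/
theorem lexMin_fst_le {S : Finset (ℚ × ℚ)} {x : ℚ × ℚ} (hx : x ∈ S) : (lexMin S).1 ≤ x.1 :=
  ((Prod.Lex.toLex_le_toLex').mp (lexMin_le hx)).1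

/-- Componentwise `≤` implies lexicographic `≤`. [folklore] -/
theorem toLex_le_of_le {x y : ℚ × ℚ} (h1 : x.1 ≤ y.1) (h2 : x.2 ≤ y.2) : toLex x ≤ toLex y :=
  (Prod.Lex.toLex_le_toLex').mpr ⟨h1, fun _ => h2⟩

/-- The minimum of the second coordinates (`ε` of Hironaka's game; `0` on `∅`). DEFINITION (data).
[cite: CossartJannsenSaito2020, Def 10.1 p.124] -/
def minSnd (S : Finset (ℚ × ℚ)) : ℚ :=
  if h : S.Nonempty then (S.image Prod.snd).min' (h.image Prod.snd) else 0

/-- `minSnd S` (the least ordinate, `ε` after swapping) is below the ordinate of every point of `S`. [folklore] -/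
theorem minSnd_le {S : Finset (ℚ × ℚ)} {x : ℚ × ℚ} (hx : x ∈ S) : minSnd S ≤ x.2 := by
  unfold minSnd
  rw [dif_pos ⟨x, hx⟩]
  exact Finset.min'_le _ _ (Finset.mem_image_of_mem Prod.snd hx)

/-- The least ordinate of a nonempty finite point set is attained. [folklore] -/
theorem exists_snd_eq_minSnd {S : Finset (ℚ × ℚ)} (h : S.Nonempty) : ∃ x ∈ S, x.2 = minSnd S := by
  unfold minSnd
  rw [dif_pos h]
  have hm := Finset.min'_mem (S.image Prod.snd) (h.image Prod.snd)
  rw [Finset.mem_image] at hm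
  obtain ⟨x, hx, hxe⟩ := hm
  exact ⟨x, hx, hxe⟩

/-- A strict lower bound for all ordinates is a strict lower bound for `minSnd`. [folklore] -/
theorem lt_minSnd {S : Finset (ℚ × ℚ)} (h : S.Nonempty) {a : ℚ} (ha : ∀ x ∈ S, a < x.2) : a < minSnd S := by
  obtain ⟨x, hx, hxe⟩ := exists_snd_eq_minSnd h
  rw [← hxe]; exact ha x hx

/-- A lower bound for all ordinates is a lower bound for `minSnd`. [folklore] -/
theorem le_minSnd {S : Finset (ℚ × ℚ)} (h : S.Nonempty) {a : ℚ} (ha : ∀ x ∈ S, a ≤ x.2) : a ≤ minSnd S := by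
  obtain ⟨x, hx, hxe⟩ := exists_snd_eq_minSnd h
  rw [← hxe]; exact ha x hx

/-- The toric map of the chart LOSING THE WALL IN SLOT 2: `Φ(x₁, x₂) = (x₁, x₁ + x₂ − 1)`. DEFINITION (data).
[cite: CossartJannsenSaito2020, Lemma 11.2 p.129] -/
def phi (x : ℚ × ℚ) : ℚ × ℚ := (x.1, x.1 + x.2 - 1)

/-- The toric map of the chart LOSING THE WALL IN SLOT 1: `Ψ(x₁, x₂) = (x₁ + x₂ − 1, x₂)`. DEFINITION (data).
[cite: CossartJannsenSaito2020, Lemma 11.1 p.129] -/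
def psi (x : ℚ × ℚ) : ℚ × ℚ := (x.1 + x.2 - 1, x.2)

/-- WildDescent (lens-5 g36) simp helper `phi_fst`, VERBATIM from the lens slice; docstring added by the writer (lint.docstring). -/
@[simp] theorem phi_fst (x : ℚ × ℚ) : (phi x).1 = x.1 := rfl
/-- WildDescent (lens-5 g36) simp helper `phi_snd`, VERBATIM from the lens slice; docstring added by the writer (lint.docstring). -/
@[simp] theorem phi_snd (x : ℚ × ℚ) : (phi x).2 = x.1 + x.2 - 1 := rfl
/-- WildDescent (lens-5 g36) simp helper `psi_fst`, VERBATIM from the lens slice; docstring added by the writer (lint.docstring). -/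
@[simp] theorem psi_fst (x : ℚ × ℚ) : (psi x).1 = x.1 + x.2 - 1 := rfl
/-- WildDescent (lens-5 g36) simp helper `psi_snd`, VERBATIM from the lens slice; docstring added by the writer (lint.docstring). -/
@[simp] theorem psi_snd (x : ℚ × ℚ) : (psi x).2 = x.2 := rfl

/-- `Φ` is lexicographically monotone. [folklore] -/
theorem toLex_phi_le {x y : ℚ × ℚ} (h : toLex x ≤ toLex y) : toLex (phi x) ≤ toLex (phi y) := by
  rw [Prod.Lex.toLex_le_toLex] at h ⊢
  rcases h with h | ⟨h1, h2⟩
  · exact Or.inl h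
  · right; refine ⟨h1, ?_⟩; simp only [phi_snd]; linarith

/-- **Φ-law of the vertex:** `lexMin (Φ S) = Φ (lexMin S)`: the wall in slot 2 is lost, `α' = α`, `β' = α + β − 1`.
[cite: CossartJannsenSaito2020, Lemma 11.2 p.129] -/
theorem lexMin_image_phi {S : Finset (ℚ × ℚ)} (h : S.Nonempty) : lexMin (S.image phi) = phi (lexMin S) := by
  refine lexMin_eq (Finset.mem_image_of_mem phi (lexMin_mem h)) fun w hw => ?_
  rw [Finset.mem_image] at hw
  obtain ⟨y, hy, rfl⟩ := hw
  exact toLex_phi_le (lexMin_le hy)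

/-- **Ψ-law of the vertex:** `β` does not increase when the wall in slot 1 is lost.
[cite: CossartJannsenSaito2020, Lemma 11.1 p.129] -/
theorem lexMin_image_psi_snd_le {S : Finset (ℚ × ℚ)} (h : S.Nonempty) : (lexMin (S.image psi)).2 ≤ (lexMin S).2 := by
  have hne : (S.image psi).Nonempty := h.image psi
  have hm := lexMin_mem hne
  rw [Finset.mem_image] at hm
  obtain ⟨y, hy, hye⟩ := hm
  have h1 := lexMin_le (Finset.mem_image_of_mem psi (lexMin_mem h))
  have h2 := lexMin_fst_le (S := S) hy
  rw [Prod.Lex.toLex_le_toLex] at h1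
  rw [← hye] at h1 ⊢
  simp only [psi_fst, psi_snd] at h1 ⊢
  rcases h1 with h1 | ⟨_, h1⟩
  · linarith
  · exact h1

/-- **Upper-closure law:** if every point of `S` dominates a point of `T` componentwise and the vertex of `T` lies in
`S`, the two vertices agree. [folklore] -/
theorem lexMin_of_upper {S T : Finset (ℚ × ℚ)} (hup : ∀ e ∈ S, ∃ y ∈ T, y.1 ≤ e.1 ∧ y.2 ≤ e.2)
    (hmem : lexMin T ∈ S) : lexMin S = lexMin T := by
  refine lexMin_eq hmem fun e he => ?_
  obtain ⟨y, hy, h1, h2⟩ := hup e he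
  exact (lexMin_le hy).trans (toLex_le_of_le h1 h2)

/-- Under upper closure the minimal second coordinate does not drop. [folklore] -/
theorem minSnd_le_of_upper {S T : Finset (ℚ × ℚ)} (hS : S.Nonempty) (hup : ∀ e ∈ S, ∃ y ∈ T, y.1 ≤ e.1 ∧ y.2 ≤ e.2) :
    minSnd T ≤ minSnd S := by
  refine le_minSnd hS fun e he => ?_
  obtain ⟨y, hy, _, h2⟩ := hup e he
  exact (minSnd_le hy).trans h2

/-- Under upper closure the minimal first coordinate does not drop. [folklore] -/
theorem lexMin_fst_le_of_upper {S T : Finset (ℚ × ℚ)} (hS : S.Nonempty)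
    (hup : ∀ e ∈ S, ∃ y ∈ T, y.1 ≤ e.1 ∧ y.2 ≤ e.2) : (lexMin T).1 ≤ (lexMin S).1 := by
  obtain ⟨y, hy, h1, _⟩ := hup _ (lexMin_mem hS)
  exact (lexMin_fst_le hy).trans h1

/-- The chart losing `v` (slot 2) acts on Hironaka's points by `Φ` (three variables `f, u, v`).
[cite: CossartJannsenSaito2020, Lemma 11.2 p.129] -/
theorem pt_chartExponent_snd [DecidableEq σ] {s : ℕ} {f u v : σ} (hfu : f ≠ u) (hfv : f ≠ v) (huv : u ≠ v)
    (hσ : ∀ i, i = f ∨ i = u ∨ i = v) {d : σ →₀ ℕ} (hd : s ≤ d.degree) (hdf : d f < s) :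
    pt s f u v (chartExponent s v d) = phi (pt s f u v d) := by
  have hdeg : d.degree = d f + d u + d v := by
    have hsub : d.support ⊆ ({f, u, v} : Finset σ) := fun i _ => by
      rcases hσ i with rfl | rfl | rfl <;> simp
    rw [Finsupp.degree_apply, Finset.sum_subset hsub (fun i _ hi => Finsupp.notMem_support_iff.mp hi),
      Finset.sum_insert (by simp [hfu, hfv]), Finset.sum_insert (by simp [huv]), Finset.sum_singleton, add_assoc]
  have hu : chartExponent s v d u = d u := by rw [PointBlowup.chartExponent_apply, if_neg huv]
  have hf : chartExponent s v d f = d f := by rw [PointBlowup.chartExponent_apply, if_neg hfv]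
  have hv : chartExponent s v d v = d.degree - s := by rw [PointBlowup.chartExponent_apply, if_pos rfl]
  unfold pt phi
  rw [hu, hf, hv]
  have hlt : ((d f : ℕ) : ℚ) < (s : ℚ) := by exact_mod_cast hdf
  have hD : ((s : ℚ) - ((d f : ℕ) : ℚ)) ≠ 0 := ne_of_gt (sub_pos.mpr hlt)
  ext
  · rfl
  · simp only
    rw [Nat.cast_sub hd, Nat.cast_sub hdf.le, hdeg]
    push_cast
    field_simp
    ring

/-- The chart losing `u` (slot 1) acts on Hironaka's points by `Ψ`.
[cite: CossartJannsenSaito2020, Lemma 11.1 p.129] -/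
theorem pt_chartExponent_fst [DecidableEq σ] {s : ℕ} {f u v : σ} (hfu : f ≠ u) (hfv : f ≠ v) (huv : u ≠ v)
    (hσ : ∀ i, i = f ∨ i = u ∨ i = v) {d : σ →₀ ℕ} (hd : s ≤ d.degree) (hdf : d f < s) :
    pt s f u v (chartExponent s u d) = psi (pt s f u v d) := by
  have h := pt_chartExponent_snd (u := v) (v := u) hfv hfu (Ne.symm huv)
    (fun i => by rcases hσ i with h | h | h <;> simp [h]) hd hdf
  unfold pt at h ⊢
  unfold phi at h; unfold psi
  simp only [Prod.mk.injEq] at h ⊢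
  refine ⟨?_, h.1⟩
  rw [h.2]; ring

end Points

end Summit.ResolutionOfSingularities.ResolutionOfSingularities.Theorems.WildDescent
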